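import Literature.Computability.AlgebraicComplexity.OrbitCoordinateRing
import Literature.Computability.AlgebraicComplexity.OrbitClosureProofs
import HarnessLib

/-!
# Coordinate ring of an orbit closure: discharge of `mem_orbitClosure_iff_formCoeff`

Sibling proofs file of `Literature/Computability/AlgebraicComplexity/OrbitCoordinateRing.lean`.
It discharges the bridge fact `Literature.Computability.AlgebraicComplexity.mem_orbitClosure_iff_formCoeff` between the orbit
closure `Δ[f]` of `OrbitClosure.lean` (Zariski closure in ALL monomial coordinates) and the
vanishing ideal `I(GL · f) ⊆ k[Sym^m]` in the degree-`m` coordinates `DegIdx σ m`: for `f` a form of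
degree `m`, `g ∈ Δ[f]` iff `g` is a form of degree `m` whose degree-`m` coefficient vector lies in
`Z(I(GL · f))`. It is the instance `P d := d ∈ degMonomials σ m` of
`mem_orbitClosure_iff_of_subtype` (`OrbitClosureProofs.lean`). The hypothesis `f ≠ 0` of the fact
is not needed.

It also proves that over an infinite field the vanishing ideal `I(GL · f)` is **prime**, i.e. the
coordinate ring `k[Δ[f]]` is an integral domain (the orbit closure of the connected group `GL` is
irreducible): `I(GL · f)` is the kernel of the *generic orbit map*
`k[Sym^m] → k[Mat_σ]`, `X_d ↦ coeff_d (Y · f)` (`Y` the generic matrix), because a polynomial on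
matrix space vanishing on `GL σ k` vanishes identically (`MvPolynomial.eq_of_eval_eq_on_gl`).
This is the irreducibility input of the semigroup property of occurring weights
(Bürgisser–Ikenmeyer–Panova 2019, Lemma 2.2: "Nonzeroness of this product follows from the
irreducibility of the variety `Ω_n`").

## Sources

* K. Mulmuley, M. Sohoni, *Geometric complexity theory I*, SIAM J. Comput. 31 (2001), §4
  (`Δ[f] ⊆ V = Sym^m`, `R[Δ[f]]`) (key `MulmuleySohoniSIAM2001`).
* P. Bürgisser, C. Ikenmeyer, G. Panova, *No occurrence obstructions in geometric complexity
  theory*, J. AMS 32 (2019) = arXiv:1604.06431v3, Lemma 2.2 (irreducibility of orbit closures)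
  (key `BurgisserIkenmeyerPanovaJAMS2019`).
-/

noncomputable section

open MvPolynomial

namespace Literature.Computability.AlgebraicComplexity

variable {σ k : Type*} [Fintype σ] [DecidableEq σ] [Field k]

/-- **Discharge of `mem_orbitClosure_iff_formCoeff`**: for a form `f` of degree `m`,
`g ∈ Δ[f] ↔ g ∈ Sym^m ∧ formCoeff m g ∈ Z(I(GL · f))`. Mulmuley–Sohoni 2001 §4 (outline D4/C8).
[cite: MulmuleySohoniSIAM2001, §4] -/
theorem mem_orbitClosure_iff_formCoeff_holds :
    mem_orbitClosure_iff_formCoeff (σ := σ) (k := k) := by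
  intro f g m hf _
  rw [mem_orbitClosure_iff_of_subtype (P := fun d => d ∈ degMonomials σ m)
    (fun d hd => mem_degMonomials_iff.mpr hd) hf, mem_homogeneousSubmodule]
  refine and_congr_right fun _ => ?_
  rw [MvPolynomial.mem_zeroLocus_iff]
  constructor
  · intro H p hp
    exact H p fun h hh => by
      obtain ⟨A, rfl⟩ := hh
      exact mem_orbitVanishingIdeal_iff.mp hp A
  · intro H p hp
    exact H p (mem_orbitVanishingIdeal_iff.mpr fun A => hp _ ⟨A, rfl⟩)

/-! ### Irreducibility: `I(GL · f)` is prime and `k[Δ[f]]` is a domain -/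

section Irreducible

/-- Values of the *generic orbit map* `k[Sym^m] → k[Mat_σ] = MvPolynomial (σ × σ) k`,
`X_d ↦ coeff_d (Y · f)` (`Y = Matrix.mvPolynomialX σ σ k` the generic matrix; the comorphism of
the orbit map `A ↦ A · f`): evaluating the image of `F` at a matrix `A` gives `F` at the
degree-`m` coefficient vector of `A · f`. (The map is written out as an `aeval`; no auxiliary
definition.) Mulmuley–Sohoni 2001 §4. [cite: MulmuleySohoniSIAM2001, §4] -/
theorem aeval_genericOrbitMap (f : MvPolynomial σ k) (m : ℕ) (F : MvPolynomial (DegIdx σ m) k)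
    (A : Matrix σ σ k) :
    aeval (fun ij : σ × σ => A ij.1 ij.2)
      (aeval (fun d : DegIdx σ m => coeff d.1 (linSubst σ (MvPolynomial (σ × σ) k)
        (Matrix.mvPolynomialX σ σ k) (map (C : k →+* MvPolynomial (σ × σ) k) f))) F) =
      aeval (formCoeff m (linSubst σ k A f)) F := by
  have hFG : (fun d : DegIdx σ m => aeval (fun ij : σ × σ => A ij.1 ij.2)
      (coeff d.1 (linSubst σ (MvPolynomial (σ × σ) k) (Matrix.mvPolynomialX σ σ k)
        (map (C : k →+* MvPolynomial (σ × σ) k) f)))) = formCoeff m (linSubst σ k A f) := by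
    funext d
    exact eval_coeff_genericLinSubst f d.1 A
  rw [← AlgHom.comp_apply, comp_aeval, hFG]

/-- Over an infinite field, the vanishing ideal `I(GL · f) ⊆ k[Sym^m]` is the kernel of the
generic orbit map `X_d ↦ coeff_d (Y · f)`: `F` vanishes on `GL · f` iff the polynomial
`A ↦ F(A · f)` on matrix space vanishes on `GL σ k`, iff it vanishes identically (`GL` is Zariski
dense in `Mat`, `MvPolynomial.eq_of_eval_eq_on_gl`). Mulmuley–Sohoni 2001 §4;
Bürgisser–Ikenmeyer–Panova 2019, proof of Lemma 2.2. [cite: MulmuleySohoniSIAM2001, §4] -/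
theorem orbitVanishingIdeal_eq_ker_genericOrbitMap [Infinite k] (f : MvPolynomial σ k) (m : ℕ) :
    orbitVanishingIdeal f m = RingHom.ker
      (aeval (fun d : DegIdx σ m => coeff d.1 (linSubst σ (MvPolynomial (σ × σ) k)
        (Matrix.mvPolynomialX σ σ k) (map (C : k →+* MvPolynomial (σ × σ) k) f))) :
        MvPolynomial (DegIdx σ m) k →ₐ[k] MvPolynomial (σ × σ) k) := by
  ext F
  rw [mem_orbitVanishingIdeal_iff, RingHom.mem_ker]
  constructor
  · intro hF
    apply MvPolynomial.eq_of_eval_eq_on_gl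
    intro g
    rw [map_zero]
    exact (aeval_genericOrbitMap f m F (g : Matrix σ σ k)).trans (hF g)
  · intro hF g
    have h := aeval_genericOrbitMap f m F (g : Matrix σ σ k)
    rw [hF, map_zero] at h
    exact h.symm

/-- **The vanishing ideal of an orbit is prime** (over an infinite field): the orbit closure
`Δ[f]` of `f` under the irreducible group `GL` is an irreducible variety. Kernel of a ring
homomorphism into the domain `MvPolynomial (σ × σ) k`. Mulmuley–Sohoni 2001 §4;
Bürgisser–Ikenmeyer–Panova 2019, proof of Lemma 2.2 ("irreducibility of the variety `Ω_n`").
[cite: BurgisserIkenmeyerPanovaJAMS2019, Lemma 2.2] -/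
theorem orbitVanishingIdeal_isPrime [Infinite k] (f : MvPolynomial σ k) (m : ℕ) :
    (orbitVanishingIdeal f m).IsPrime := by
  rw [orbitVanishingIdeal_eq_ker_genericOrbitMap]
  exact RingHom.ker_isPrime _

/-- **The coordinate ring `k[Δ[f]]` of an orbit closure is an integral domain** (over an
infinite field). Bürgisser–Ikenmeyer–Panova 2019, proof of Lemma 2.2.
[cite: BurgisserIkenmeyerPanovaJAMS2019, Lemma 2.2] -/
theorem isDomain_orbitCoordRing [Infinite k] (f : MvPolynomial σ k) (m : ℕ) :
    IsDomain (OrbitCoordRing f m) :=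
  (Ideal.Quotient.isDomain_iff_prime _).mpr (orbitVanishingIdeal_isPrime f m)

end Irreducible

end Literature.Computability.AlgebraicComplexity
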